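import Summits.QuantumFields.YangMills.Theorems.BalabanUVNodesN22AtRecordOfKernelFading
import Summits.QuantumFields.YangMills.Theorems.BalabanUVNodesN22AtRecordOfOutputCoordHoloPrinted

/-!
# NODE N22 (NE9) — «J38 AT THE RECORD» IN PRINT-LEVEL CURRENCY: K3's `h9` WITH THE RECORD's GEOMETRIC MODULI and the N22 pin face from node N18's kernel step rate + OUTPUT-level
# coupling holomorphy with ONE radius ([I] p. 266 read quantitatively) + PRINTED (2.38) + PRINTED configuration analyticity `AnalyticH` ([II] p. 15) — dag-n22-c g14's J40
# `ne9_EA_objectsOfRecord₁₃_of_kernelStepRate_outputCoordHolo'` with its ONE non-print binder (term holomorphy through the readings) DISCHARGED by this seat's p621851 §0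

Cell `pub-ymgap`, Track A (HUMAN RULING D-0062), WIDTH SEAT `dag-n22-w5` (g0′, harness re-seat of base w5) on node n22 = NE9, D-0154 (3a) second width wave;
`--kind proof --supports stmt-QuantumFields-27366 --as helper` (KEY MAP v2, pub-ymgap INBOX 2026-08-28T10:04Z: K3⁸ `SpineGivenEndpointR13SepCoPHV`; K3⁷ 20544 aside, its v5 §2b
sockets `h9` ∕ `N22At` unchanged in shape), COUNT-NEUTRAL; THEOREMS ONLY (0 `def`, 0 `sorry`, standard axioms).  Self-located in this seat's own lineage (CLAIM-6 on the bus).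
CONTEXT.  dag-n22-c g14's LOCATED finding (INBOX 2026-08-28T09:14Z; referee ref-Q READ-50): the (β′)-letter-at-record compositions with tables UNIFORM in the age `n − i` are vacuous
modulo degenerate data against the record's GEOMETRIC moduli `ℓ.moduli n i = C₉·ω^{n−i}`, `ω < 1`, and margin tables force radii growing with age; the NON-VACUOUS repair of record is
J38–J40 (`…N22AtRecordOfKernelFading`, p62xxxx): node N18's kernel step rate supplies the geometric gain, the output-level margin datum `hL` needs ONE radius `ρ₀`.  J40's theorems
display ONE binder that is not at print's level — `hEhol`, holomorphy of the (2.13) TERM through the complexified reading; this seat's `…N22AtRecordOfOutputCoordHoloPrinted` §0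
`differentiableOn_E_comp_of_printedSlots` (p621851) derives it from PRINTED (2.38) `Bound238` + Road 1's numerals + PRINTED `AnalyticH` + holomorphic readings (dag-n22-c J30 v1.1's
engine ∘ J32′ §1).  THIS FILE makes that substitution in J40's primed headline — one application each; nothing of J38–J41 ∕ p621851 is re-declared.

WHAT.  ★★★ `ne9_EA_objectsOfRecord₁₃_of_kernelStepRate_outputCoordHolo_analyticH` — `NE9 ((objectsOfRecord₁₃ F N θ ℓ).EA 0) (Window θ.γ) ℓ.κ ℓ.moduli` (K3's `h9`, the record's
GEOMETRIC moduli) from: `ℓ.Signs`, `0 < θ.γ`; node N18's `KernelStepRateOfRecord₁₃ F N θ κ₅ ℓ.θ₅ C₅` (`0 ≤ C₅`); W1-20's law `Localizes17OfRecord₁₃ F N θ S emb` for towers `S K :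
ClusterTower (F.P K) 𝔸 M` (`M = L^{m′}`, `𝔸` a normed ℂ-algebra); the OUTPUT-LEVEL margin datum `hL` with ONE radius `ρ₀` (bound `B·e^{−κ_E d_{k+1}(X)}`, `κ ≤ κ_E`); PRINTED (2.38)
`Bound238 (box θ.γ k) (sp K k) A R` and PRINTED `AnalyticH (box θ.γ k) (sp K k)`; Road 1's numerals (`0 ≤ A`, `0 ≤ r₁`, `r₁ + 128 log 162 + 2 ≤ R`, `A·e^{5r₁+1}K₀(64,8)·9·64 ≤ 1`);
HOLOMORPHIC complexified probe readings `Φ K k X` of the record's β-chart (open `U ⊇ ball 0 r`, chart clause, dag-n22-w3's space clause); site weights with the minimizer tails, `δ₀ > 0`,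
`2κ₀(64,8) ≤ κ`; `PolLimitsExistOfRecord₁₃ F N θ`; rows `δ₁ ≤ κ₅`, `0 < ℓ.ω`, `ℓ.θ₅ ≤ ℓ.ω²`, `ℓ.κ ≤ δ₁`, `(4·(2C₅∕(1−ℓ.θ₅) + 2E₁)∕θ.γ + C₂·θ.γ∕2)∕ℓ.ω ≤ ℓ.C₉` (J40's constants).
★★★ `n22At_rateCarriers_of_kernels_pin_of_kernelStepRate_outputCoordHolo_analyticH` — the N22 pin face `N22At (rateCarriersOfRecord₁₃CoPH 𝔯 F θ hP g₀ os k).u3` for EVERY `k` under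
`hpin`, from the same inputs at `θ.toStage13Params` (dag-n22-w3's `n22At_rateCarriers_of_kernels_pin_of_ne9`).
THE N22 ROW SENTENCE, PRINT-LEVEL AND NON-VACUOUS AT THE JUNCTION: «N18's kernel step rate + [I] p. 266 coupling analyticity of the (2.13) terms on ONE uniform margin + printed (2.38) +
printed configuration analyticity + holomorphic minimizer readings + p. 282 tails + W1-20's law + (1.21) + letter rows satisfiable under `ℓ.Signs` ⇒ K3's `h9` ∕ `N22At` with the
record's geometric moduli, every run length».

HONEST FRAMING (binding).  Count-neutral COMPOSITION of landed theorems by name; NO estimate of Bałaban's is proved or asserted; every displayed input is a HYPOTHESIS with its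
owner (N18's kernel step rate: node N18 ∕ the N18 desks; output-level coupling margins: N10 ∕ NODE A older, N09 last — the uniform margin is the cell's QUANTIFIED reading of [I]
p. 263 ∕ p. 266 «C^∞ (or analytic)», NOT a printed estimate; printed (2.38) ∕ `AnalyticH`: N10 ∕ NODE A; readings + tails: NODE A ∕ N09; law: NODE A ∕ N10 ∕ def-W1; (1.21):
dag-n22-w3's road); nothing of the record is constructed or claimed to meet them; N22 is NOT discharged (typed 28∕28 · discharged 5∕27 UNCHANGED); K3⁸ OPEN and NOT claimed (no stub of
27366 is touched); NE9 is NOT IN PRINT for d = 4; no count claim (the chair's single count line is the only count); no summit statement is proved by this seat; one finite 𝕋⁴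
programme at fixed ε — R4 closes the CONDITIONAL rung `BalabanLadder.UV` only; NOTHING about the continuum limit, ℝ⁴, infinite volume, OS axioms, a mass gap or the Clay problem is
proved or claimed by any of this.  References (TYPES only, no cite tags on the Summit side): [I] = Bałaban, CMP 109 (1987) (1.7) p. 261, §1 p. 263, §2 p. 266, (1.18) p. 263,
(1.20)–(1.21) p. 264, p. 282, (5.10) p. 293; [II] = CMP 116 (1988) (2.13)–(2.14) pp. 14–15, p. 15, (2.38) p. 20, (2.41) p. 21; King, CMP 102 (1986) Lemma 4.5 (the N18 mechanism's print).
-/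

noncomputable section

open Filter Topology Metric Set
open scoped BigOperators

namespace YMDAG.N22.AtRecordOfPrintedSlots

open Literature.MathematicalPhysics.QuantumFieldTheory.Balaban1983to89
open Literature.MathematicalPhysics.QuantumFieldTheory.Balaban1983to89.T4Continuum (T4Family ULoop)
open Literature.MathematicalPhysics.QuantumFieldTheory.Balaban1983to89.T4OutputRate (Window NE9)
open Literature.MathematicalPhysics.QuantumFieldTheory.Balaban1983to89.Node00 (Stage13Params Stage13HParams U3Letters₁₁ MatA)
open Literature.MathematicalPhysics.QuantumFieldTheory.Balaban1983to89.Node00.Sect2 (domCount domSys CPair)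
open Literature.MathematicalPhysics.QuantumFieldTheory.Balaban1983to89.Node00.LocalizedSum17 (ReadingMaps Localizes17OfRecord₁₃)
open Literature.MathematicalPhysics.QuantumFieldTheory.Balaban1983to89.Node00.W1 (ClusterTower ClusterStep box)
open Literature.MathematicalPhysics.QuantumFieldTheory.Balaban1983to89.Node00.U3OfKernels (histPrefix objectsOfRecord₁₃)
open Literature.MathematicalPhysics.QuantumFieldTheory.Balaban1983to89.Node00.U3KernelLetters (KernelStepRateOfRecord₁₃ PolLimitsExistOfRecord₁₃)
open Literature.MathematicalPhysics.QuantumFieldTheory.Balaban1983to89.B12Decay510 (delta1)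
open Literature.MathematicalPhysics.QuantumFieldTheory.Balaban1983to89.B12Decay510Window (K₁)
open Literature.MathematicalPhysics.QuantumFieldTheory.Balaban1983to89.B12Decay510Torus (distCT nearT)
open Literature.MathematicalPhysics.QuantumFieldTheory.Balaban1983to89.B12TreeDecay (K₀ kappa₀)
open Literature.MathematicalPhysics.QuantumFieldTheory.Balaban1983to89.TreeLengthTorus (TPt)
open YMDAG.UVSplit (N22At RateReading₁₃CoPH rateCarriersOfRecord₁₃CoPH)
open YMDAG.N22.AtKernels (n22At_rateCarriers_of_kernels_pin_of_ne9)
open YMDAG.N22.KernelFading (ne9_EA_objectsOfRecord₁₃_of_kernelStepRate_outputCoordHolo')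

open scoped Matrix.Norms.L2Operator

variable (F : T4Family) (N : ℕ) [NeZero N]

open Classical in
/-- ★★★ **K3's `h9` WITH THE RECORD's GEOMETRIC MODULI, PRINT-LEVEL** — J40's `ne9_EA_objectsOfRecord₁₃_of_kernelStepRate_outputCoordHolo'` with the term-holomorphy binder `hEhol`
DISCHARGED by p621851 §0 `differentiableOn_E_comp_of_printedSlots` (PRINTED (2.38) + numerals + PRINTED `AnalyticH` + holomorphic readings) and J34's space clause read from dag-n22-w3's by
`ball_mem_sp_of_spaceClause`: `ℓ.Signs` + `0 < θ.γ` + N18's `KernelStepRateOfRecord₁₃ F N θ κ₅ ℓ.θ₅ C₅` + law + output-level margins with ONE radius `ρ₀` + `Bound238` ∕ `AnalyticH` on the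
boxes + numerals + holomorphic readings + tails + `PolLimitsExistOfRecord₁₃ F N θ` + J40's rows ⟹ `NE9 ((objectsOfRecord₁₃ F N θ ℓ).EA 0) (Window θ.γ) ℓ.κ ℓ.moduli`.  LOCATED (hypothesis form);
N22 NOT discharged. -/
theorem ne9_EA_objectsOfRecord₁₃_of_kernelStepRate_outputCoordHolo_analyticH (θ : Stage13Params F N) (ℓ : U3Letters₁₁) (hs : ℓ.Signs) (hγ : 0 < θ.γ)
    (hlim : PolLimitsExistOfRecord₁₃ F N θ) {κ₅ C₅ : ℝ} (hC₅ : 0 ≤ C₅) (h5 : KernelStepRateOfRecord₁₃ F N θ κ₅ ℓ.θ₅ C₅)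
    {𝔸 : Type*} [NormedRing 𝔸] [NormedAlgebra ℂ 𝔸] (m' : ℕ) (M : ℕ) [NeZero M] (hM : M = F.L ^ m')
    (S : (K : ℕ) → ClusterTower (F.P K) 𝔸 M) (emb : ReadingMaps F (MatA N) 𝔸) (hloc : Localizes17OfRecord₁₃ F N θ S emb)
    (sp : (K k : ℕ) → (domSys (F.P K) M (k + 1)).Dom → Set (CPair (F.P K) 𝔸))
    {A R r₁ κ κE δ₀ B₃ r B ρ₀ : ℝ} (hρ₀ : 0 < ρ₀)
    (hA : 0 ≤ A) (hr₁ : 0 ≤ r₁) (hrate : r₁ + 2 * (64 * Real.log 162) + 2 ≤ R) (hsmall : A * Real.exp (5 * r₁ + 1) * K₀ 64 8 * 9 * 64 ≤ 1)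
    (hκ₀ : kappa₀ (4 * 2 ^ 4) (2 * 4) ≤ κ / 2) (hδ₀ : 0 < δ₀) (hB₃ : 0 ≤ B₃) (hr : 0 < r) (hB : 0 ≤ B) (hκE : κ ≤ κE)
    (hL : ∀ (K k : ℕ) (i : Fin (k + 1)), ∀ g ∈ box θ.γ k, ∀ (X : (domSys (F.P K) M (k + 1)).Dom), ∀ φ ∈ sp K k X,
      ∃ (Ec : ℂ → ℂ) (O : Set ℂ), DifferentiableOn ℂ Ec O ∧ (∀ t ∈ Ioc (0 : ℝ) θ.γ, closedBall (t : ℂ) ρ₀ ⊆ O) ∧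
        (∀ z ∈ O, ‖Ec z‖ ≤ B * Real.exp (-(κE * (domSys (F.P K) M (k + 1)).dj X))) ∧
        (∀ t ∈ Ioc (0 : ℝ) θ.γ, Ec t = ((S K) k).E (Function.update g i t) φ X))
    (h238 : ∀ K k, ((S K) k).Bound238 (box θ.γ k) (sp K k) A R) (hAn : ∀ K k, ((S K) k).AnalyticH (box θ.γ k) (sp K k))
    (Ec : ℕ → ℕ → Type*) [∀ K k, NormedAddCommGroup (Ec K k)] [∀ K k, NormedSpace ℂ (Ec K k)]
    (ι : letI := θ.instVβ₁; letI := θ.instVβ₂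
      (K k : ℕ) → (domSys (F.P K) M (k + 1)).Dom → ((Fin (F.P K).d → Site (F.P K) (k + 1) → θ.Vβ) →L[ℝ] Ec K k))
    (Φ : (K k : ℕ) → (domSys (F.P K) M (k + 1)).Dom → Ec K k → CPair (F.P K) 𝔸)
    (U : (K k : ℕ) → (domSys (F.P K) M (k + 1)).Dom → Set (Ec K k)) (hU : ∀ K k X, IsOpen (U K k X)) (hrU : ∀ K k X, ball (0 : Ec K k) r ⊆ U K k X)
    (hΦhol : ∀ (K k : ℕ) (X : (domSys (F.P K) M (k + 1)).Dom), DifferentiableOn ℂ (Φ K k X) (U K k X))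
    (hΦemb : letI := θ.instVβ₁; letI := θ.instVβ₂
      ∀ (K k : ℕ) (X : (domSys (F.P K) M (k + 1)).Dom) (Bf : Fin (F.P K).d → Site (F.P K) (k + 1) → θ.Vβ),
        Φ K k X (ι K k X Bf) = emb K k (fun l t => NormedSpace.exp (θ.ρ8 (Bf l t))))
    (hΦsp : ∀ (K k : ℕ) (X : (domSys (F.P K) M (k + 1)).Dom), ∀ z ∈ U K k X, ∀ Z : (domSys (F.P K) M (k + 1)).Dom, Z.1 ⊆ X.1 → Φ K k X z ∈ sp K k Z)
    (w : (K k : ℕ) → (domSys (F.P K) M (k + 1)).Dom → Site (F.P K) (k + 1) → ℝ) (hw₀ : ∀ K k X t, 0 ≤ w K k X t)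
    (hw : letI := θ.instVβ₁; letI := θ.instVβ₂; letI := θ.instιβ
      ∀ (K k : ℕ) (X : (domSys (F.P K) M (k + 1)).Dom) (l : Fin (F.P K).d) (t : Site (F.P K) (k + 1)) (c : θ.ιβ),
        ‖ι K k X (Pi.single l (Pi.single t (θ.bV c)))‖ ≤ w K k X t)
    (htail : ∀ (K k : ℕ) (X : (domSys (F.P K) M (k + 1)).Dom) (t : Site (F.P K) (k + 1)),
      let e : Site (F.P K) (k + 1) → TPt 4 (domCount (F.P K) M (k + 1) * M) := fun x i => (ZMod.cast (x i) : ZMod (domCount (F.P K) M (k + 1) * M))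
      w K k X t ≤ B₃ * Real.exp (-δ₀ * distCT (domCount (F.P K) M (k + 1)) M (e t) (nearT (M := M) (e t) X)))
    (hκ₅ : delta1 δ₀ κ ((M : ℝ) * 4) ≤ κ₅) (hω : 0 < ℓ.ω) (hθω : ℓ.θ₅ ≤ ℓ.ω ^ 2) (hℓκ : ℓ.κ ≤ delta1 δ₀ κ ((M : ℝ) * 4))
    (hC₉ : (4 * (2 * C₅ / (1 - ℓ.θ₅) +
        2 * ((16 * B * B₃ ^ 2 / r ^ 2) * Real.exp (delta1 δ₀ κ ((M : ℝ) * 4) * ((M : ℝ) * 4) * 3) * K₀ (4 * 2 ^ 4) (2 * 4) * K₁ 4 (δ₀ / 2))) / θ.γ +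
        ((16 * (64 * B / ρ₀ ^ 2) * B₃ ^ 2 / r ^ 2) * Real.exp (delta1 δ₀ κ ((M : ℝ) * 4) * ((M : ℝ) * 4) * 3) * K₀ (4 * 2 ^ 4) (2 * 4) *
          K₁ 4 (δ₀ / 2)) * θ.γ / 2) / ℓ.ω ≤ ℓ.C₉) :
    NE9 ((objectsOfRecord₁₃ F N θ ℓ).EA 0) (Window θ.γ) ℓ.κ ℓ.moduli :=
  ne9_EA_objectsOfRecord₁₃_of_kernelStepRate_outputCoordHolo' F N θ ℓ hs hγ hlim hC₅ h5 m' M hM S emb hloc sp hρ₀ hκ₀ hδ₀ hB₃ hr hB hκE hL Ec ι Φ U hU hrU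
    (differentiableOn_E_comp_of_printedSlots F S sp hA hr₁ hrate hsmall h238 hAn Ec Φ U hU hΦhol hΦsp)
    hΦemb (ball_mem_sp_of_spaceClause F sp Ec Φ U hrU hΦsp) w hw₀ hw htail hκ₅ hω hθω hℓκ hC₉

open Classical in
/-- ★★★ **THE N22 PIN FACE, PRINT-LEVEL AND NON-VACUOUS AT THE JUNCTION** — `N22At (rateCarriersOfRecord₁₃CoPH 𝔯 F θ hP g₀ os k).u3` for EVERY `k` under `hpin`:
`ne9_EA_objectsOfRecord₁₃_of_kernelStepRate_outputCoordHolo_analyticH` at `θ.toStage13Params` fed to dag-n22-w3's `n22At_rateCarriers_of_kernels_pin_of_ne9`.  «N18's kernel step rate +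
[I] p. 266 coupling analyticity on ONE uniform margin + printed (2.38) + printed configuration analyticity + holomorphic minimizer readings + p. 282 tails + law + (1.21) + letter rows
⇒ `N22At` with the record's geometric moduli, every run length».  LOCATED (hypothesis form); N22 NOT discharged. -/
theorem n22At_rateCarriers_of_kernels_pin_of_kernelStepRate_outputCoordHolo_analyticH (𝔯 : RateReading₁₃CoPH N) (θ : Stage13HParams F N) (hP : θ.Provisos₁₃CoPH F N)
    (g₀ : ℕ → ℝ) (os : List (ULoop F)) (ℓ : U3Letters₁₁) (hs : ℓ.Signs) (hγ : 0 < θ.γ)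
    (hpin : (𝔯.lit F θ hP g₀ os).u3 = objectsOfRecord₁₃ F N θ.toStage13Params ℓ)
    (hlim : PolLimitsExistOfRecord₁₃ F N θ.toStage13Params) {κ₅ C₅ : ℝ} (hC₅ : 0 ≤ C₅) (h5 : KernelStepRateOfRecord₁₃ F N θ.toStage13Params κ₅ ℓ.θ₅ C₅)
    {𝔸 : Type*} [NormedRing 𝔸] [NormedAlgebra ℂ 𝔸] (m' : ℕ) (M : ℕ) [NeZero M] (hM : M = F.L ^ m')
    (S : (K : ℕ) → ClusterTower (F.P K) 𝔸 M) (emb : ReadingMaps F (MatA N) 𝔸) (hloc : Localizes17OfRecord₁₃ F N θ.toStage13Params S emb)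
    (sp : (K k : ℕ) → (domSys (F.P K) M (k + 1)).Dom → Set (CPair (F.P K) 𝔸))
    {A R r₁ κ κE δ₀ B₃ r B ρ₀ : ℝ} (hρ₀ : 0 < ρ₀)
    (hA : 0 ≤ A) (hr₁ : 0 ≤ r₁) (hrate : r₁ + 2 * (64 * Real.log 162) + 2 ≤ R) (hsmall : A * Real.exp (5 * r₁ + 1) * K₀ 64 8 * 9 * 64 ≤ 1)
    (hκ₀ : kappa₀ (4 * 2 ^ 4) (2 * 4) ≤ κ / 2) (hδ₀ : 0 < δ₀) (hB₃ : 0 ≤ B₃) (hr : 0 < r) (hB : 0 ≤ B) (hκE : κ ≤ κE)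
    (hL : ∀ (K k : ℕ) (i : Fin (k + 1)), ∀ g ∈ box θ.γ k, ∀ (X : (domSys (F.P K) M (k + 1)).Dom), ∀ φ ∈ sp K k X,
      ∃ (Ec : ℂ → ℂ) (O : Set ℂ), DifferentiableOn ℂ Ec O ∧ (∀ t ∈ Ioc (0 : ℝ) θ.γ, closedBall (t : ℂ) ρ₀ ⊆ O) ∧
        (∀ z ∈ O, ‖Ec z‖ ≤ B * Real.exp (-(κE * (domSys (F.P K) M (k + 1)).dj X))) ∧
        (∀ t ∈ Ioc (0 : ℝ) θ.γ, Ec t = ((S K) k).E (Function.update g i t) φ X))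
    (h238 : ∀ K k, ((S K) k).Bound238 (box θ.γ k) (sp K k) A R) (hAn : ∀ K k, ((S K) k).AnalyticH (box θ.γ k) (sp K k))
    (Ec : ℕ → ℕ → Type*) [∀ K k, NormedAddCommGroup (Ec K k)] [∀ K k, NormedSpace ℂ (Ec K k)]
    (ι : letI := θ.instVβ₁; letI := θ.instVβ₂
      (K k : ℕ) → (domSys (F.P K) M (k + 1)).Dom → ((Fin (F.P K).d → Site (F.P K) (k + 1) → θ.Vβ) →L[ℝ] Ec K k))
    (Φ : (K k : ℕ) → (domSys (F.P K) M (k + 1)).Dom → Ec K k → CPair (F.P K) 𝔸)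
    (U : (K k : ℕ) → (domSys (F.P K) M (k + 1)).Dom → Set (Ec K k)) (hU : ∀ K k X, IsOpen (U K k X)) (hrU : ∀ K k X, ball (0 : Ec K k) r ⊆ U K k X)
    (hΦhol : ∀ (K k : ℕ) (X : (domSys (F.P K) M (k + 1)).Dom), DifferentiableOn ℂ (Φ K k X) (U K k X))
    (hΦemb : letI := θ.instVβ₁; letI := θ.instVβ₂
      ∀ (K k : ℕ) (X : (domSys (F.P K) M (k + 1)).Dom) (Bf : Fin (F.P K).d → Site (F.P K) (k + 1) → θ.Vβ),
        Φ K k X (ι K k X Bf) = emb K k (fun l t => NormedSpace.exp (θ.ρ8 (Bf l t))))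
    (hΦsp : ∀ (K k : ℕ) (X : (domSys (F.P K) M (k + 1)).Dom), ∀ z ∈ U K k X, ∀ Z : (domSys (F.P K) M (k + 1)).Dom, Z.1 ⊆ X.1 → Φ K k X z ∈ sp K k Z)
    (w : (K k : ℕ) → (domSys (F.P K) M (k + 1)).Dom → Site (F.P K) (k + 1) → ℝ) (hw₀ : ∀ K k X t, 0 ≤ w K k X t)
    (hw : letI := θ.instVβ₁; letI := θ.instVβ₂; letI := θ.instιβ
      ∀ (K k : ℕ) (X : (domSys (F.P K) M (k + 1)).Dom) (l : Fin (F.P K).d) (t : Site (F.P K) (k + 1)) (c : θ.ιβ),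
        ‖ι K k X (Pi.single l (Pi.single t (θ.bV c)))‖ ≤ w K k X t)
    (htail : ∀ (K k : ℕ) (X : (domSys (F.P K) M (k + 1)).Dom) (t : Site (F.P K) (k + 1)),
      let e : Site (F.P K) (k + 1) → TPt 4 (domCount (F.P K) M (k + 1) * M) := fun x i => (ZMod.cast (x i) : ZMod (domCount (F.P K) M (k + 1) * M))
      w K k X t ≤ B₃ * Real.exp (-δ₀ * distCT (domCount (F.P K) M (k + 1)) M (e t) (nearT (M := M) (e t) X)))
    (hκ₅ : delta1 δ₀ κ ((M : ℝ) * 4) ≤ κ₅) (hω : 0 < ℓ.ω) (hθω : ℓ.θ₅ ≤ ℓ.ω ^ 2) (hℓκ : ℓ.κ ≤ delta1 δ₀ κ ((M : ℝ) * 4))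
    (hC₉ : (4 * (2 * C₅ / (1 - ℓ.θ₅) +
        2 * ((16 * B * B₃ ^ 2 / r ^ 2) * Real.exp (delta1 δ₀ κ ((M : ℝ) * 4) * ((M : ℝ) * 4) * 3) * K₀ (4 * 2 ^ 4) (2 * 4) * K₁ 4 (δ₀ / 2))) / θ.γ +
        ((16 * (64 * B / ρ₀ ^ 2) * B₃ ^ 2 / r ^ 2) * Real.exp (delta1 δ₀ κ ((M : ℝ) * 4) * ((M : ℝ) * 4) * 3) * K₀ (4 * 2 ^ 4) (2 * 4) *
          K₁ 4 (δ₀ / 2)) * θ.γ / 2) / ℓ.ω ≤ ℓ.C₉) (k : ℕ) :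
    N22At (rateCarriersOfRecord₁₃CoPH 𝔯 F θ hP g₀ os k).u3 :=
  n22At_rateCarriers_of_kernels_pin_of_ne9 𝔯 θ hP g₀ os ℓ hs hpin
    (ne9_EA_objectsOfRecord₁₃_of_kernelStepRate_outputCoordHolo_analyticH F N θ.toStage13Params ℓ hs hγ hlim hC₅ h5 m' M hM S emb hloc sp hρ₀ hA hr₁ hrate hsmall
      hκ₀ hδ₀ hB₃ hr hB hκE hL h238 hAn Ec ι Φ U hU hrU hΦhol hΦemb hΦsp w hw₀ hw htail hκ₅ hω hθω hℓκ hC₉) k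

end YMDAG.N22.AtRecordOfPrintedSlots

end
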